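import Summits.AnomalousDissipation.AnomalousDissipation.Theses.MomentParity
import Summits.AnomalousDissipation.AnomalousDissipation.Theorems.MomentParityResolvedDissipationTrajectoryUI

/-!
# A super-Leray local window resolves the dissipation
# (crux `MomentParity.ResolvedDissipation`, stmt-AnomalousDissipation-14284, line `enstrophy-ui-transfer`)

Supports stmt-AnomalousDissipation-14284 (lead c5). Nothing here closes the item: the hypothesis (SLW) is
regularity-class.

Write `S^N_t = Torus.galerkinFlow ν f N t`, `Z = Torus.eGradNormSq`. The tree now holds, uniformly in the
Galerkin order `N`, LERAY'S local propagation of enstrophy (`TrajectoryUILocalWindow.galerkin_enstrophy_local_bound`,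
p141524): from mean-zero data with `Z ≤ g` the enstrophy stays `≤ 2g+1` on a window `[0, T(g)]` with
`T(g) ≍ ν³/(C₀⁴ g²)`, i.e. `g · T(g) → 0`. This file proves that ANY improvement of that window by one power of
the level closes the crux:

**SLW (super-Leray window) at `(f, ν, R)`**: for every `C` there are a level `g ≥ C`, a window `T > 0` with
`g · T ≥ C`, and a finite ceiling `M` such that for EVERY order `N` every mean-zero Galerkin mode `a` of order `N`
with `‖a‖₂² ≤ R²`, `Z(a) ≤ g` has `Z(S^N_t a) ≤ M` for `t ∈ (0, T)`.

* `uniformIntegrability_of_superLerayWindow` — SLW at `(f, ν, R)` ⟹ the `N`-uniform uniform integrability of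
  the enstrophy over the admissible laws at `(f, ν, R)` (hypothesis of the landed Reduction, verbatim). PROOF —
  the glue of `TrajectoryUI.uniformIntegrability_of_trajectoryUI_of_stubs` (lead c4) re-run with a
  level-dependent window: by invariance (`stub_invarianceAveraging`) `E_μ[Z; Z>M] = T⁻¹ E_μ ∫₀ᵀ (Z 1{Z>M})(S_t u) dt`;
  on `{Z(u) ≤ g}` the integrand VANISHES (ceiling); on `{Z(u) > g}` the time integral is at most
  `b(T) = (R² + T‖f‖₂²/(4π²ν))/ν` (`stub_pathwiseDissipation`) times `1 ≤ Z(u)/g`, of mean `≤ bud/g`,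
  `bud = ‖f‖₂|R|/ν` (`ensembleEnstrophy_le_budget`). Total: `T⁻¹ b(T) bud/g = (R²/ν)·bud/(gT) + (‖f‖₂²/(4π²ν²))·bud/g
  ≤ (R²/ν + ‖f‖₂²/(4π²ν²))·bud/C`, small for `C` large. Leray's window gives `gT ≍ ν³/(C₀⁴g)`: ONE POWER SHORT
  (STRATEGY-CENSUS S⁺2, now quantified by theorems on both sides).
* `resolvedAt_of_superLerayWindow`, `resolvedDissipation_of_superLerayWindow` — hence the crux's conclusion at
  `(f, ν, R)`, and `ResolvedDissipation` BY NAME from SLW at every `(f, ν, R)`.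

So the crux is implied by an `N`-uniform local `H¹`-propagation time `T(g)` for the Galerkin systems with
`limsup g·T(g) = ∞` — any super-scaling (ε-supercritical) local theory; GEB (`resolvedDissipation_of_enstrophyCeiling`)
is the case `T(g) ≡ T`.

References: Leray 1934 §20; Foias–Manley–Rosa–Temam 2001 Ch. II App. A (A.55)–(A.58), Ch. IV App. B;
Tao arXiv:0710.1604 Thm 1.4; Robinson–Rodrigo–Sadowski 2016 Lemma 6.12.
-/

noncomputable section

-- `Summit.<Summit>.<Problem>`: single-conjunct summit, the duplicate namespace segment is mandated.
set_option linter.dupNamespace false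

namespace Summit.AnomalousDissipation.AnomalousDissipation.Theorems.MomentParityResolvedDissipation.SuperLerayWindow

open MeasureTheory Filter Topology Set
open scoped ENNReal InnerProductSpace RealInnerProductSpace
open Literature.Analysis.FunctionSpaces Literature.Analysis.FluidPDE
open Summit.AnomalousDissipation.AnomalousDissipation.Theses.MomentParity
open Summit.AnomalousDissipation.AnomalousDissipation.Theorems.CubicParityLoud.Negative (T3 R3 H3 L2T3)
open Summit.AnomalousDissipation.AnomalousDissipation.Theorems.QuarticGate.Negative
  (IsLevel IsBandTest polyGrad IsPolyStationary)

/-- **Parameter choice**: for `A, bud ≥ 0` and `ε' > 0`, the constant `C = A · bud / ε' + 1 > 0` has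
`A · (bud / C) ≤ ε'`. [folklore] -/
theorem exists_constant {A bud ε' : ℝ} (hA : 0 ≤ A) (hbud : 0 ≤ bud) (hε : 0 < ε') :
    ∃ C : ℝ, 0 < C ∧ A * (bud / C) ≤ ε' := by
  refine ⟨A * bud / ε' + 1, by positivity, ?_⟩
  have hC : 0 < A * bud / ε' + 1 := by positivity
  rw [← mul_div_assoc, div_le_iff₀ hC]
  have : A * bud = ε' * (A * bud / ε') := by field_simp
  nlinarith [mul_nonneg hA hbud]

/-- **SLW ⟹ U.** A super-Leray local window at `(f, ν, R)` (for every `C` a level `g ≥ C`, a window `T > 0` with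
`C ≤ g·T` and a finite `N`-uniform enstrophy ceiling on `(0, T)` for mean-zero Galerkin data in the `L²`-ball of
radius `R` with `Z ≤ g`) implies the `N`-uniform uniform integrability of the enstrophy over the admissible laws at
`(f, ν, R)` (the hypothesis of `resolvedDissipation_of_uniformIntegrability`, verbatim). Invariance averaging +
vanishing good part + Markov on the bad part, as in the module docstring. -/
theorem uniformIntegrability_of_superLerayWindow
    (f : T3 → R3) (hf : Torus.IsSmooth f) (h0 : Torus.HasZeroMean f) (ν : ℝ) (hν : 0 < ν) (R : ℝ)
    (hSLW : ∀ C : ℝ, ∃ g : ℝ, C ≤ g ∧ 0 < g ∧ ∃ T : ℝ, 0 < T ∧ C ≤ g * T ∧ ∃ M : ℝ≥0∞, M ≠ ⊤ ∧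
      ∀ (N : ℕ) (a : T3 → R3), IsGalerkinMode N a → Torus.HasZeroMean a → ∫ x, ‖a x‖ ^ 2 ≤ R ^ 2 →
        Torus.eGradNormSq a ≤ ENNReal.ofReal g →
        ∀ t ∈ Set.Ioo 0 T, Torus.eGradNormSq (Torus.galerkinFlow ν f N t a) ≤ M) :
    ∀ ε : ℝ≥0∞, 0 < ε → ∃ M : ℝ≥0∞, M ≠ ⊤ ∧
        ∀ (N : ℕ) (μ : Measure (Torus.energySpace (Fin 3))), IsProbabilityMeasure μ →
          (∀ᵐ u ∂μ, IsLevel N u) → (∀ᵐ u ∂μ, ‖u‖ ≤ R) → (∀ d : ℕ, IsPolyStationary ν f N d μ) →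
          ∫⁻ u in {u : Torus.energySpace (Fin 3) |
              M < Torus.eGradNormSq (u.1 : UnitAddTorus (Fin 3) → EuclideanSpace ℝ (Fin 3))},
            Torus.eGradNormSq (u.1 : UnitAddTorus (Fin 3) → EuclideanSpace ℝ (Fin 3)) ∂μ ≤ ε := by
  -- adapted from `TrajectoryUI.uniformIntegrability_of_trajectoryUI_of_stubs` (lead c4, p140175)
  intro ε hε
  -- a real tolerance `ε'` below `ε`
  set ε' : ℝ := if ε = ⊤ then 1 else ε.toReal with hε'
  have hε'pos : 0 < ε' := by
    rw [hε']
    split_ifs with h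
    · exact one_pos
    · exact ENNReal.toReal_pos hε.ne' h
  have hε'le : ENNReal.ofReal ε' ≤ ε := by
    rw [hε']
    split_ifs with h
    · rw [h]; exact le_top
    · exact ENNReal.ofReal_toReal_le
  -- the constants
  have hf2 : 0 ≤ ∫ x, ‖f x‖ ^ 2 := integral_nonneg fun _ => by positivity
  set A : ℝ := R ^ 2 / ν + (∫ x, ‖f x‖ ^ 2) / (4 * Real.pi ^ 2 * ν ^ 2) with hA
  have hA0 : 0 ≤ A := by positivity
  set bud : ℝ := Real.sqrt (∫ x, ‖f x‖ ^ 2) * |R| / ν with hbud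
  have hbud0 : 0 ≤ bud := by positivity
  obtain ⟨C, hC, hgoal⟩ := exists_constant hA0 hbud0 hε'pos
  obtain ⟨g, hCg, hg, T, hT, hCgT, M, hM, hceil⟩ := hSLW C
  set b : ℝ := (R ^ 2 + T * (∫ x, ‖f x‖ ^ 2) / (4 * Real.pi ^ 2 * ν)) / ν with hb
  have hb0 : 0 ≤ b := by positivity
  -- the key arithmetic: `T⁻¹ · b · bud/g ≤ A · bud/C ≤ ε'`
  have hkey : T⁻¹ * (b * (bud * g⁻¹)) ≤ ε' := by
    have h1 : T⁻¹ * (b * (bud * g⁻¹)) = (R ^ 2 / ν) * (bud / (g * T)) +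
        (∫ x, ‖f x‖ ^ 2) / (4 * Real.pi ^ 2 * ν ^ 2) * (bud / g) := by
      rw [hb]; field_simp
    have h2 : bud / (g * T) ≤ bud / C := div_le_div_of_nonneg_left hbud0 hC hCgT
    have h3 : bud / g ≤ bud / C := div_le_div_of_nonneg_left hbud0 hC hCg
    have h4 : (R ^ 2 / ν) * (bud / (g * T)) + (∫ x, ‖f x‖ ^ 2) / (4 * Real.pi ^ 2 * ν ^ 2) * (bud / g) ≤
        A * (bud / C) := by
      rw [hA, add_mul]
      gcongr
    linarith
  refine ⟨M, hM, fun N μ hP hL hB hS => ?_⟩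
  -- notation
  set S : Finset (Fin 3 → ℤ) := Torus.freqBall (d := Fin 3) N with hSdef
  have hSsym : ∀ k ∈ S, -k ∈ S := fun k hk => Torus.neg_mem_freqBall_of_mem k hk
  set Θ : H3 → (↥S → EuclideanSpace ℂ (Fin 3)) := fun u => fourierRestrict S (u.1 : T3 → R3) with hΘ
  have hΘmem : ∀ u : H3, Θ u ∈ galerkinSubspace S := fun u =>
    MomentParity.fourierRestrict_coe_mem_galerkinSubspace N u
  set zr : (↥S → EuclideanSpace ℂ (Fin 3)) → ℝ := fun c =>
    4 * Real.pi ^ 2 * ∑ k ∈ S, Torus.freqNormSq k * ‖Torus.coeffExt S c k‖ ^ 2 with hzr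
  set F : (↥S → EuclideanSpace ℂ (Fin 3)) → ℝ≥0∞ := fun c =>
    (Set.Ioi M).indicator id (ENNReal.ofReal (zr c)) with hF
  have hFm : Measurable F :=
    (measurable_id.indicator measurableSet_Ioi).comp
      (ENNReal.measurable_ofReal.comp (TrajectoryUI.continuous_bandEnstrophy S).measurable)
  -- the band enstrophy is the spectral enstrophy on the phase space
  have hZr : ∀ c ∈ galerkinSubspace S,
      Torus.eGradNormSq (Torus.realTrigPoly S (Torus.coeffExt S c)) = ENNReal.ofReal (zr c) :=
    fun c hc => Torus.eGradNormSq_realTrigPoly hSsym (hc.1.isConjSymm_coeffExt hSsym)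
  -- measurability of the enstrophy on `H`
  have hZm : Measurable fun u : H3 => Torus.eGradNormSq (u.1 : T3 → R3) := Torus.measurable_eGradNormSq_coe
  -- Step 1: the tail integral as the integral of the truncated enstrophy
  have h1 : ∫⁻ u in {u : H3 | M < Torus.eGradNormSq (u.1 : T3 → R3)}, Torus.eGradNormSq (u.1 : T3 → R3) ∂μ =
      ∫⁻ u, (Set.Ioi M).indicator id (Torus.eGradNormSq (u.1 : T3 → R3)) ∂μ := by
    rw [← lintegral_indicator (measurableSet_lt measurable_const hZm)]
    refine lintegral_congr fun u => ?_
    simp only [Set.indicator, Set.mem_setOf_eq, Set.mem_Ioi, id]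
  -- Step 2: a.e. the truncated enstrophy is `F ∘ Θ`
  have h2 : ∀ᵐ u ∂μ, (Set.Ioi M).indicator id (Torus.eGradNormSq (u.1 : T3 → R3)) = F (Θ u) := by
    filter_upwards [hL] with u hu
    have h4 := (LevelCoeff.stub_levelCoeff N u hu).2.2.2
    simp only [hF]
    rw [← hZr _ (hΘmem u), ← h4]
  -- Step 3 (pointwise): the inner time integral along the orbit of a.e. `u`
  have h4 : ∀ᵐ u ∂μ, (∫⁻ t in Set.Ioo 0 T, F (galerkinCoeffFlow ν (fourierRestrict S f) t (Θ u))) ≤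
      ENNReal.ofReal b * (Torus.eGradNormSq (u.1 : T3 → R3) / ENNReal.ofReal g) := by
    filter_upwards [hL, hB] with u hu hub
    obtain ⟨hmode, hmean, hnorm, hgrad⟩ := LevelCoeff.stub_levelCoeff N u hu
    set a : T3 → R3 := Torus.realTrigPoly S (Torus.coeffExt S (Θ u)) with ha
    -- conjugacy: the orbit of `a` read through `F`
    have hflow : ∀ t, F (galerkinCoeffFlow ν (fourierRestrict S f) t (Θ u)) =
        (Set.Ioi M).indicator id (Torus.eGradNormSq (Torus.galerkinFlow ν f N t a)) := by
      intro t
      simp only [hF]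
      rw [ha, Torus.galerkinFlow_realTrigPoly (hΘmem u) t, hZr _ (galerkinCoeffFlow_mem (hΘmem u) t)]
    simp_rw [hflow]
    have hR2 : ∫ x, ‖a x‖ ^ 2 ≤ R ^ 2 := by
      rw [hnorm]
      exact pow_le_pow_left₀ (norm_nonneg _) hub 2
    by_cases hsmall : Torus.eGradNormSq (u.1 : T3 → R3) ≤ ENNReal.ofReal g
    · -- good data: the integrand vanishes on `(0, T)` (the ceiling)
      have hzero : ∀ t ∈ Set.Ioo 0 T,
          (Set.Ioi M).indicator id (Torus.eGradNormSq (Torus.galerkinFlow ν f N t a)) = 0 := fun t ht =>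
        Set.indicator_of_notMem (fun h : Torus.eGradNormSq (Torus.galerkinFlow ν f N t a) ∈ Set.Ioi M =>
          (not_lt.2 (hceil N a hmode hmean hR2 (hgrad.symm ▸ hsmall) t ht)) h) _
      rw [setLIntegral_congr_fun measurableSet_Ioo hzero, lintegral_zero]
      exact bot_le
    · replace hsmall := not_le.1 hsmall
      have hmeanflow := ZeroMeanFlow.stub_zeroMean_galerkinFlow ν hν.le f hf h0 N a hmode hmean
      have hpath := PathwiseDissipation.stub_pathwiseDissipation ν hν f hf N a hmode hmeanflow T hT.le
      have hle_b : ENNReal.ofReal ((∫ x, ‖a x‖ ^ 2 + T * (∫ x, ‖f x‖ ^ 2) / (4 * Real.pi ^ 2 * ν)) / ν) ≤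
          ENNReal.ofReal b := by
        refine ENNReal.ofReal_le_ofReal ?_
        -- NB: the registered bound reads `∫ x, (‖a x‖² + const)`; on the probability space `T³` this is
        -- `∫‖a‖² + const`.
        have hai : Integrable (fun x => ‖a x‖ ^ 2) volume :=
          (hmode.isSmooth.continuous.norm.pow 2).integrable_unitAddTorus
        have hnum : ∫ x, ‖a x‖ ^ 2 + T * (∫ x, ‖f x‖ ^ 2) / (4 * Real.pi ^ 2 * ν) ≤
            R ^ 2 + T * (∫ x, ‖f x‖ ^ 2) / (4 * Real.pi ^ 2 * ν) := by
          rw [integral_add hai (integrable_const _), integral_const, probReal_univ, one_smul]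
          exact add_le_add hR2 le_rfl
        exact div_le_div_of_nonneg_right hnum hν.le
      have hone : 1 ≤ Torus.eGradNormSq (u.1 : T3 → R3) / ENNReal.ofReal g := by
        rw [ENNReal.le_div_iff_mul_le (Or.inl (ENNReal.ofReal_pos.2 hg).ne') (Or.inl ENNReal.ofReal_ne_top),
          one_mul]
        exact hsmall.le
      calc (∫⁻ t in Set.Ioo 0 T, (Set.Ioi M).indicator id (Torus.eGradNormSq (Torus.galerkinFlow ν f N t a)))
          ≤ ∫⁻ t in Set.Ioo 0 T, Torus.eGradNormSq (Torus.galerkinFlow ν f N t a) :=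
            lintegral_mono fun t => Set.indicator_le_self _ _ _
        _ ≤ ENNReal.ofReal b := hpath.trans hle_b
        _ ≤ ENNReal.ofReal b * (Torus.eGradNormSq (u.1 : T3 → R3) / ENNReal.ofReal g) := by
            simpa only [mul_one] using mul_le_mul_right hone (ENNReal.ofReal b)
  -- the budget
  have hbudget : ∫⁻ u, Torus.eGradNormSq (u.1 : T3 → R3) ∂μ ≤ ENNReal.ofReal bud := by
    have := ensembleEnstrophy_le_budget hν (hf.memLp 2) hP hL hB hS
    refine this.trans (ENNReal.ofReal_le_ofReal ?_)
    rw [hbud]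
    gcongr
    exact le_abs_self R
  -- assemble
  calc ∫⁻ u in {u : H3 | M < Torus.eGradNormSq (u.1 : T3 → R3)}, Torus.eGradNormSq (u.1 : T3 → R3) ∂μ
      = ∫⁻ u, F (Θ u) ∂μ := by rw [h1]; exact lintegral_congr_ae h2
    _ = (ENNReal.ofReal T)⁻¹ *
          ∫⁻ u, (∫⁻ t in Set.Ioo 0 T, F (galerkinCoeffFlow ν (fourierRestrict S f) t (Θ u))) ∂μ :=
        InvarianceAveraging.stub_invarianceAveraging ν hν f hf h0 N R μ hP hL hB hS T hT F hFm
    _ ≤ (ENNReal.ofReal T)⁻¹ * ∫⁻ u,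
          ENNReal.ofReal b * (Torus.eGradNormSq (u.1 : T3 → R3) / ENNReal.ofReal g) ∂μ := by
        exact mul_le_mul_right (lintegral_mono_ae h4) _
    _ = (ENNReal.ofReal T)⁻¹ *
          (ENNReal.ofReal b * ((∫⁻ u, Torus.eGradNormSq (u.1 : T3 → R3) ∂μ) * (ENNReal.ofReal g)⁻¹)) := by
        rw [lintegral_const_mul' _ _ ENNReal.ofReal_ne_top]
        simp_rw [div_eq_mul_inv]
        rw [lintegral_mul_const' _ _ (ENNReal.inv_ne_top.2 (ENNReal.ofReal_pos.2 hg).ne')]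
    _ ≤ (ENNReal.ofReal T)⁻¹ * (ENNReal.ofReal b * (ENNReal.ofReal bud * (ENNReal.ofReal g)⁻¹)) := by
        gcongr
    _ = ENNReal.ofReal (T⁻¹ * (b * (bud * g⁻¹))) := by
        rw [← ENNReal.ofReal_inv_of_pos hg, ← ENNReal.ofReal_inv_of_pos hT,
          ← ENNReal.ofReal_mul hbud0, ← ENNReal.ofReal_mul hb0, ← ENNReal.ofReal_mul (inv_nonneg.2 hT.le)]
    _ ≤ ENNReal.ofReal ε' := ENNReal.ofReal_le_ofReal hkey
    _ ≤ ε := hε'le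

/-- **SLW ⟹ the crux's conclusion at `(f, ν, R)`**: a super-Leray local window at `(f, ν, R)` (smooth zero-mean
force, `ν > 0`) yields ONE resolution schedule `κ` for all admissible laws at all levels, via the landed Reduction
`resolvedDissipation_of_uniformIntegrability`. -/
theorem resolvedAt_of_superLerayWindow
    (f : T3 → R3) (hf : Torus.IsSmooth f) (h0 : Torus.HasZeroMean f) (ν : ℝ) (hν : 0 < ν) (R : ℝ)
    (hSLW : ∀ C : ℝ, ∃ g : ℝ, C ≤ g ∧ 0 < g ∧ ∃ T : ℝ, 0 < T ∧ C ≤ g * T ∧ ∃ M : ℝ≥0∞, M ≠ ⊤ ∧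
      ∀ (N : ℕ) (a : T3 → R3), IsGalerkinMode N a → Torus.HasZeroMean a → ∫ x, ‖a x‖ ^ 2 ≤ R ^ 2 →
        Torus.eGradNormSq a ≤ ENNReal.ofReal g →
        ∀ t ∈ Set.Ioo 0 T, Torus.eGradNormSq (Torus.galerkinFlow ν f N t a) ≤ M) :
    ∃ κ : ℕ → ℕ, ∀ (N : ℕ) (μ : Measure (Torus.energySpace (Fin 3))), IsProbabilityMeasure μ →
      (∀ᵐ u ∂μ, IsLevel N u) → (∀ᵐ u ∂μ, ‖u‖ ≤ R) → (∀ d : ℕ, IsPolyStationary ν f N d μ) →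
      ∀ n : ℕ, ∫⁻ u, Torus.eGradNormSq (u.1 : UnitAddTorus (Fin 3) → EuclideanSpace ℝ (Fin 3)) ∂μ ≤
        (∫⁻ u, Torus.eGradNormSq (Torus.fourierTruncate (κ n)
          (u.1 : UnitAddTorus (Fin 3) → EuclideanSpace ℝ (Fin 3))) ∂μ) + ((n : ℝ≥0∞) + 1)⁻¹ :=
  resolvedDissipation_of_uniformIntegrability f hf ν hν R
    (uniformIntegrability_of_superLerayWindow f hf h0 ν hν R hSLW)

/-- **SLW (at every force, viscosity and radius) ⟹ `ResolvedDissipation`** (the route decl BY NAME): the crux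
follows from ANY `N`-uniform local `H¹`-propagation time for the Galerkin systems that beats Leray's by one power
of the level along some sequence of levels (`limsup g·T(g) = ∞`). The divergence-free clause is not needed. -/
theorem resolvedDissipation_of_superLerayWindow
    (hSLW : ∀ f : UnitAddTorus (Fin 3) → EuclideanSpace ℝ (Fin 3),
      Torus.IsSmooth f → Torus.IsDivFree f → Torus.HasZeroMean f → ∀ ν : ℝ, 0 < ν → ∀ R : ℝ,
      ∀ C : ℝ, ∃ g : ℝ, C ≤ g ∧ 0 < g ∧ ∃ T : ℝ, 0 < T ∧ C ≤ g * T ∧ ∃ M : ℝ≥0∞, M ≠ ⊤ ∧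
        ∀ (N : ℕ) (a : UnitAddTorus (Fin 3) → EuclideanSpace ℝ (Fin 3)),
          IsGalerkinMode N a → Torus.HasZeroMean a → ∫ x, ‖a x‖ ^ 2 ≤ R ^ 2 →
          Torus.eGradNormSq a ≤ ENNReal.ofReal g →
          ∀ t ∈ Set.Ioo 0 T, Torus.eGradNormSq (Torus.galerkinFlow ν f N t a) ≤ M) :
    ResolvedDissipation := by
  intro f hf hdiv hzero ν hν R
  obtain ⟨κ, hκ⟩ := resolvedAt_of_superLerayWindow f hf hzero ν hν R (hSLW f hf hdiv hzero ν hν R)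
  refine ⟨κ, fun N μ hp hl hb hs n => hκ N μ hp hl hb ?_ n⟩
  intro d m g P hg _
  exact hs m g P hg

/-! ## Registered tools stub -/

/-- **Registered tools stub `stub_superLerayWindow` of stmt-AnomalousDissipation-14284** (line
`enstrophy-ui-transfer`; `ledger workitem stub-add … --name stub_superLerayWindow`): a super-Leray local window for
the Galerkin systems at every `(f, ν, R)` implies the crux. [folklore] -/
theorem stub_superLerayWindow :
    (∀ f : UnitAddTorus (Fin 3) → EuclideanSpace ℝ (Fin 3),
      Literature.Analysis.FunctionSpaces.Torus.IsSmooth f →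
      Literature.Analysis.FunctionSpaces.Torus.IsDivFree f →
      Literature.Analysis.FunctionSpaces.Torus.HasZeroMean f → ∀ ν : ℝ, 0 < ν → ∀ R : ℝ,
      ∀ C : ℝ, ∃ g : ℝ, C ≤ g ∧ 0 < g ∧ ∃ T : ℝ, 0 < T ∧ C ≤ g * T ∧ ∃ M : ENNReal, M ≠ ⊤ ∧
        ∀ (N : ℕ) (a : UnitAddTorus (Fin 3) → EuclideanSpace ℝ (Fin 3)),
          Literature.Analysis.FluidPDE.IsGalerkinMode N a →
          Literature.Analysis.FunctionSpaces.Torus.HasZeroMean a → ∫ x, ‖a x‖ ^ 2 ≤ R ^ 2 →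
          Literature.Analysis.FunctionSpaces.Torus.eGradNormSq a ≤ ENNReal.ofReal g →
          ∀ t ∈ Set.Ioo 0 T,
            Literature.Analysis.FunctionSpaces.Torus.eGradNormSq
              (Literature.Analysis.FluidPDE.Torus.galerkinFlow ν f N t a) ≤ M) →
    Summit.AnomalousDissipation.AnomalousDissipation.Theses.MomentParity.ResolvedDissipation :=
  resolvedDissipation_of_superLerayWindow

end Summit.AnomalousDissipation.AnomalousDissipation.Theorems.MomentParityResolvedDissipation.SuperLerayWindow

end
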